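import Literature.Analysis.FluidPDE.Tao2016AveragedNS.SplitCascadeReduction
import HarnessLib

/-!
# Tao 2016, §4 and §6.2: local pseudo-solutions of the cascade ODE and generic shell checkpoints

T. Tao, *Finite time blowup for an averaged three-dimensional Navier–Stokes equation*, J. Amer.
Math. Soc. **29** (2016) 601–674 = arXiv:1402.0290v3 [`Tao2016AveragedNS`]: §4, Lemma 4.1
(conclusions (4.5)–(4.11)) and Theorem 4.2; §6.2, Proposition 6.3 ((vi)–(ix), (6.9)–(6.12)) and the
deduction "Theorem 6.2 ⇐ Proposition 6.3" (p. 32).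

This module (definition request `defn-CascadeODESolutionOn` of cell harvest/h2-tao-ladder, planner
theory-1 g5; source cell file `TaoLadderRung2.lean`, sha16 ad4dc2766c9eb84c) supplies, next to the
tree's GLOBAL format `TaoCascade.CascadeODESolutionFrom` (`SplitCascadeReduction.lean`), the
vocabulary for a general table of structure constants:

* `CascadeODESolutionOn T …` — the conclusions (4.5)–(4.11) of Lemma 4.1 on a finite horizon `[0,T]`
  (every time hypothesis `t ∈ [0,T]`, one-sided derivatives within `[0,T]`), with the restriction
  theorems `CascadeODESolutionFrom.restrict` (global ⇒ local on `[0,T]`, `T > 0`) and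
  `CascadeODESolutionOn.mono` (`[0,T] ⇒ [0,T']`, `0 < T' ≤ T`);
* `ShellCheckpoints ε₀ θ c i₀ n₀ X₀ P N X E t e` — Proposition 6.3-type checkpoint data up to level
  `N` for a general table: anchor (6.9)–(6.10), amplitude (vi), monotone times with the lifespan
  bound (6.11) `t_n − t_{n−1} ≤ c(1+ε₀)^{−5(n−1)/2}/e_{n−1}`, the amplitude ratio (6.12)
  `e_n ≥ (1+ε₀)^{−θ} e_{n−1}` (Tao: `c ≍ 1`, `θ = 1/10`), and a witness-chosen transition-state
  description `P` of the rescaled window state ((6.13)–(6.18) are such a `P`);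
* `datumState`, `datumEnergy` — the rescaled one-shell datum;
* cell vocabulary, clearly marked (section `CellVocabulary`): comparability of a table with spread
  `R` (`IsComparableCoeff`, the class `InTableClass`), "Theorem 4.2-level blow-up" of one table
  (`NoGlobalCascade`, its exact slice `NoGlobalExactCascade`) and the local robust induction
  predicate `ComparableDynamicsLocal` — PREDICATES (definitions with parameters), not assertions.

THEOREMS: the restriction lemmas, and the generic **"Theorem 6.2 ⇐ Proposition 6.3"** bookkeeping
of Tao's §6.2 (p. 32) for an arbitrary table — `ShellCheckpoints.rpow_mul_le_amp` (amplitudes decay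
at most geometrically), `ShellCheckpoints.time_le` / `time_le_uniform` (lifespans summable for
`θ < 5/2`, uniform horizon), `CascadeODESolutionFrom.false_of_shellCheckpoints` (checkpoints at every
level contradict the a priori bound (4.5), via Bernoulli), packaged as the cell's support statement
`checkpointContradiction` WITH ITS PROOF `checkpointContradiction_holds` (0 unproved facts), and
`noGlobalCascade_of_forall_shellCheckpoints`. Nothing is asserted about any particular table. MODEL
lattice objects only — nothing here is a statement about the Navier–Stokes equations. The cell's
rung claims (`@[conjecture] RungTwoLatt` …) and `localDynamicsSuffices` (which mentions them) are NOT
vendored here (route items of `Theses/TaoLadderRungTwo.lean`).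
-/

noncomputable section

open Set MeasureTheory intervalIntegral

namespace Literature.Analysis.FluidPDE

namespace TaoCascade

/-! ### One-sided derivatives: `[0,T]` versus `[0,+∞)` -/

section Deriv

/-- For a `C¹` function on `[0,+∞)` the derivative within `[0,T]` (`T > 0`) agrees with the
derivative within `[0,+∞)` on `[0,T]`. [cite: Tao2016AveragedNS, §4 Lemma 4.1 (i) ("continuously differentiable … on [0,+∞)")] -/
theorem derivWithin_Icc_eq_derivWithin_Ici {f : ℝ → ℝ} {T t : ℝ} (hf : ContDiffOn ℝ 1 f (Ici 0))
    (hT : 0 < T) (ht : t ∈ Icc 0 T) :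
    derivWithin f (Icc 0 T) t = derivWithin f (Ici 0) t :=
  (((hf.differentiableOn one_ne_zero) t ht.1).hasDerivWithinAt.mono Icc_subset_Ici_self).derivWithin
    (uniqueDiffOn_Icc hT t ht)

/-- For a `C¹` function on `[0,T]` the derivative within `[0,T']` (`0 < T' ≤ T`) agrees with the
derivative within `[0,T]` on `[0,T']`. [cite: Tao2016AveragedNS, §4 Lemma 4.1 (i)] -/
theorem derivWithin_Icc_eq_derivWithin_Icc {f : ℝ → ℝ} {T T' t : ℝ} (hf : ContDiffOn ℝ 1 f (Icc 0 T))
    (hT' : 0 < T') (hT'T : T' ≤ T) (ht : t ∈ Icc 0 T') :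
    derivWithin f (Icc 0 T') t = derivWithin f (Icc 0 T) t :=
  (((hf.differentiableOn one_ne_zero) t ⟨ht.1, ht.2.trans hT'T⟩).hasDerivWithinAt.mono
    (Icc_subset_Icc_right hT'T)).derivWithin (uniqueDiffOn_Icc hT' t ht)

end Deriv

/-! ### Local pseudo-solutions: the conclusions of Lemma 4.1 on `[0,T]` -/

/-- **The conclusions (4.5)–(4.11) of Tao's Lemma 4.1 on a finite time interval `[0,T]`** (LOCAL
pseudo-solution for the table `α`, implied constants `K₁, K₂`, one-shell datum `X₀` at shell `n₀`):
the same displays as `CascadeODESolutionFrom` with every time hypothesis restricted to `[0,T]` and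
one-sided derivatives within `[0,T]`. Local solutions exist for every table (for instance local
solutions of the exactly damped lattice), so statements quantified over them are not vacuous.
[cite: Tao2016AveragedNS, §4 Lemma 4.1 (4.5)–(4.11)] -/
structure CascadeODESolutionOn (T ε₀ : ℝ) {m : ℕ}
    (α : Fin m → Fin m → Fin m → ℤ × ℤ × ℤ → ℝ) (K₁ K₂ : ℝ) (n₀ : ℤ) (X₀ : Fin m → ℝ)
    (X E : Fin m → ℤ → ℝ → ℝ) : Prop where
  /-- `X_{i,n}` is continuously differentiable on `[0,T]`. -/
  contDiffOn_X : ∀ i n, ContDiffOn ℝ 1 (X i n) (Icc 0 T)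
  /-- `E_{i,n}` is continuously differentiable on `[0,T]`. -/
  contDiffOn_E : ∀ i n, ContDiffOn ℝ 1 (E i n) (Icc 0 T)
  /-- `E_{i,n} ≥ 0` on `[0,T]`. -/
  nonneg_E : ∀ i n t, t ∈ Icc 0 T → 0 ≤ E i n t
  /-- (4.5), coefficients, on `[0,T]`. -/
  apriori_X : ∃ M : ℝ, ∀ t ∈ Icc 0 T, ∀ (i : Fin m) (n : ℤ),
    (1 + (1 + ε₀) ^ ((10 : ℝ) * n)) * |X i n t| ≤ M
  /-- (4.5), energies, on `[0,T]`. -/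
  apriori_E : ∃ M : ℝ, ∀ t ∈ Icc 0 T, ∀ (i : Fin m) (n : ℤ),
    (1 + (1 + ε₀) ^ ((10 : ℝ) * n)) * Real.sqrt (E i n t) ≤ M
  /-- (4.6). -/
  init_E : ∀ i n, E i n 0 = (1 / 2) * X i n 0 ^ 2
  /-- (4.7) for the one-shell datum `X₀`. -/
  init_X : ∀ i n, X i n 0 = if n = n₀ then X₀ i else 0
  /-- (4.8) on `[0,T]` (one-sided derivative within `[0,T]`). -/
  motion : ∀ i n t, t ∈ Icc 0 T →
    |derivWithin (X i n) (Icc 0 T) t - quadTerm ε₀ α X i n t| ≤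
      K₁ * (1 + ε₀) ^ ((2 : ℝ) * n) * Real.sqrt (E i n t)
  /-- (4.9) on `[0,T]`. -/
  energy : ∀ i n t, t ∈ Icc 0 T →
    derivWithin (E i n) (Icc 0 T) t ≤ quadTerm ε₀ α X i n t * X i n t
  /-- (4.10), lower, on `[0,T]`. -/
  defect_lower : ∀ i n t, t ∈ Icc 0 T → (1 / 2) * X i n t ^ 2 ≤ E i n t
  /-- (4.10), upper, on `[0,T]`. -/
  defect_upper : ∀ i n t, t ∈ Icc 0 T →
    E i n t ≤ (1 / 2) * X i n t ^ 2 + K₂ * (1 + ε₀) ^ ((2 : ℝ) * n) * ∫ s in (0 : ℝ)..t, E i n s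
  /-- (4.11), coefficients, on `[0,T]`. -/
  noLow_X : ∀ i n t, n < n₀ → t ∈ Icc 0 T → X i n t = 0
  /-- (4.11), energies, on `[0,T]`. -/
  noLow_E : ∀ i n t, n < n₀ → t ∈ Icc 0 T → E i n t = 0

/-- **Global ⇒ local**: a global pseudo-solution restricts to a local one on every `[0,T]`, `T > 0`.
[cite: Tao2016AveragedNS, §4 Lemma 4.1 (4.5)–(4.11)] -/
theorem CascadeODESolutionFrom.restrict {ε₀ : ℝ} {m : ℕ}
    {α : Fin m → Fin m → Fin m → ℤ × ℤ × ℤ → ℝ} {K₁ K₂ : ℝ} {n₀ : ℤ} {X₀ : Fin m → ℝ}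
    {X E : Fin m → ℤ → ℝ → ℝ} (h : CascadeODESolutionFrom ε₀ α K₁ K₂ n₀ X₀ X E)
    {T : ℝ} (hT : 0 < T) : CascadeODESolutionOn T ε₀ α K₁ K₂ n₀ X₀ X E where
  contDiffOn_X i n := (h.contDiffOn_X i n).mono Icc_subset_Ici_self
  contDiffOn_E i n := (h.contDiffOn_E i n).mono Icc_subset_Ici_self
  nonneg_E i n t ht := h.nonneg_E i n t ht.1
  apriori_X := h.apriori_X T hT
  apriori_E := h.apriori_E T hT
  init_E := h.init_E
  init_X := h.init_X
  motion i n t ht := by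
    rw [derivWithin_Icc_eq_derivWithin_Ici (h.contDiffOn_X i n) hT ht]
    exact h.motion i n t ht.1
  energy i n t ht := by
    rw [derivWithin_Icc_eq_derivWithin_Ici (h.contDiffOn_E i n) hT ht]
    exact h.energy i n t ht.1
  defect_lower i n t ht := h.defect_lower i n t ht.1
  defect_upper i n t ht := h.defect_upper i n t ht.1
  noLow_X i n t hn ht := h.noLow_X i n t hn ht.1
  noLow_E i n t hn ht := h.noLow_E i n t hn ht.1

/-- **Shrinking the horizon**: a local pseudo-solution on `[0,T]` is one on `[0,T']`, `0 < T' ≤ T`.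
[cite: Tao2016AveragedNS, §4 Lemma 4.1 (4.5)–(4.11)] -/
theorem CascadeODESolutionOn.mono {T T' ε₀ : ℝ} {m : ℕ}
    {α : Fin m → Fin m → Fin m → ℤ × ℤ × ℤ → ℝ} {K₁ K₂ : ℝ} {n₀ : ℤ} {X₀ : Fin m → ℝ}
    {X E : Fin m → ℤ → ℝ → ℝ} (h : CascadeODESolutionOn T ε₀ α K₁ K₂ n₀ X₀ X E)
    (hT' : 0 < T') (hT'T : T' ≤ T) : CascadeODESolutionOn T' ε₀ α K₁ K₂ n₀ X₀ X E where
  contDiffOn_X i n := (h.contDiffOn_X i n).mono (Icc_subset_Icc_right hT'T)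
  contDiffOn_E i n := (h.contDiffOn_E i n).mono (Icc_subset_Icc_right hT'T)
  nonneg_E i n t ht := h.nonneg_E i n t ⟨ht.1, ht.2.trans hT'T⟩
  apriori_X := by
    obtain ⟨M, hM⟩ := h.apriori_X
    exact ⟨M, fun t ht i n => hM t ⟨ht.1, ht.2.trans hT'T⟩ i n⟩
  apriori_E := by
    obtain ⟨M, hM⟩ := h.apriori_E
    exact ⟨M, fun t ht i n => hM t ⟨ht.1, ht.2.trans hT'T⟩ i n⟩
  init_E := h.init_E
  init_X := h.init_X
  motion i n t ht := by
    rw [derivWithin_Icc_eq_derivWithin_Icc (h.contDiffOn_X i n) hT' hT'T ht]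
    exact h.motion i n t ⟨ht.1, ht.2.trans hT'T⟩
  energy i n t ht := by
    rw [derivWithin_Icc_eq_derivWithin_Icc (h.contDiffOn_E i n) hT' hT'T ht]
    exact h.energy i n t ⟨ht.1, ht.2.trans hT'T⟩
  defect_lower i n t ht := h.defect_lower i n t ⟨ht.1, ht.2.trans hT'T⟩
  defect_upper i n t ht := h.defect_upper i n t ⟨ht.1, ht.2.trans hT'T⟩
  noLow_X i n t hn ht := h.noLow_X i n t hn ⟨ht.1, ht.2.trans hT'T⟩
  noLow_E i n t hn ht := h.noLow_E i n t hn ⟨ht.1, ht.2.trans hT'T⟩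

/-- The value of the observable at time `0` is the datum. [cite: Tao2016AveragedNS, §4 (4.7)] -/
theorem CascadeODESolutionOn.X_zero_self {T ε₀ : ℝ} {m : ℕ}
    {α : Fin m → Fin m → Fin m → ℤ × ℤ × ℤ → ℝ} {K₁ K₂ : ℝ} {n₀ : ℤ} {X₀ : Fin m → ℝ}
    {X E : Fin m → ℤ → ℝ → ℝ} (h : CascadeODESolutionOn T ε₀ α K₁ K₂ n₀ X₀ X E) (i : Fin m) :
    X i n₀ 0 = X₀ i := by
  rw [h.init_X, if_pos rfl]

/-! ### Generic shell checkpoints (Proposition 6.3 (vi)–(ix), (6.9)–(6.12), for an arbitrary table) -/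

/-- **Shell checkpoints up to level `N`** for a family `X, E` (any table, `m` modes, observable mode
`i₀`, one-shell datum `X₀` at `n₀`), with a witness-chosen transition-state description `P` of the
rescaled window state `(k ↦ X_{i,n+k}(t_n)/e_n, k ↦ E_{i,n+k}(t_n)/e_n²)` (Tao's (6.13)–(6.18) are
such a `P`): (anchor, (6.9)–(6.10)) `t_{n₀} = 0`, `e_{n₀} = |X₀ i₀|`; (amplitude, (vi)) `0 < e_n ≤
|X_{i₀,n}(t_n)|`; (state, (viii)) `P` holds at every checkpoint; (clock, (vii) and (6.11))
`t_{n−1} < t_n ≤ t_{n−1} + c(1+ε₀)^{−5(n−1)/2}/e_{n−1}`; (ratio, (6.12)) `e_n ≥ (1+ε₀)^{−θ} e_{n−1}`.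
Tao's Proposition 6.3 is the instance `m = 4`, `i₀ = 1`, `X₀ = 1_{i₀}`, `θ = 1/10`, `c ≍ 1`, `P` =
(6.13)–(6.18) (tree: `TaoCascade.BlowupCheckpoints`). [cite: Tao2016AveragedNS, §6.2 Prop. 6.3 (vi)–(ix), (6.9)–(6.12)] -/
structure ShellCheckpoints (ε₀ θ c : ℝ) {m : ℕ} (i₀ : Fin m) (n₀ : ℤ) (X₀ : Fin m → ℝ)
    (P : (Fin m → ℤ → ℝ) → (Fin m → ℤ → ℝ) → Prop) (N : ℤ)
    (X E : Fin m → ℤ → ℝ → ℝ) (t e : ℤ → ℝ) : Prop where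
  /-- anchor: `t_{n₀} = 0`. -/
  t_init : t n₀ = 0
  /-- anchor: `e_{n₀} = |X₀ i₀|`. -/
  e_init : e n₀ = |X₀ i₀|
  /-- amplitudes are positive. -/
  e_pos : ∀ n, n₀ ≤ n → n ≤ N → 0 < e n
  /-- the observable mode of shell `n` carries amplitude at least `e_n` at time `t_n`. -/
  amp : ∀ n, n₀ ≤ n → n ≤ N → e n ≤ |X i₀ n (t n)|
  /-- the transition-state description holds at every checkpoint (rescaled window state). -/
  state : ∀ n, n₀ ≤ n → n ≤ N →
    P (fun i k => X i (n + k) (t n) / e n) (fun i k => E i (n + k) (t n) / e n ^ 2)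
  /-- checkpoint times increase. -/
  mono : ∀ n, n₀ < n → n ≤ N → t (n - 1) < t n
  /-- lifespan bound `t_n - t_{n-1} ≤ c (1+ε₀)^{-5(n-1)/2} e_{n-1}⁻¹`. -/
  life : ∀ n, n₀ < n → n ≤ N →
    t n - t (n - 1) ≤ c * (1 + ε₀) ^ (-(5 : ℝ) * (n - 1) / 2) * (e (n - 1))⁻¹
  /-- amplitude ratio `e_n ≥ (1+ε₀)^{-θ} e_{n-1}`. -/
  ratio : ∀ n, n₀ < n → n ≤ N → (1 + ε₀) ^ (-θ) * e (n - 1) ≤ e n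

/-- Checkpoints up to level `N` restrict to checkpoints up to any lower level `N' ≥ n₀`... in fact to
any `N' ≤ N`. [cite: Tao2016AveragedNS, §6.2 Prop. 6.3] -/
theorem ShellCheckpoints.mono_level {ε₀ θ c : ℝ} {m : ℕ} {i₀ : Fin m} {n₀ : ℤ} {X₀ : Fin m → ℝ}
    {P : (Fin m → ℤ → ℝ) → (Fin m → ℤ → ℝ) → Prop} {N N' : ℤ} {X E : Fin m → ℤ → ℝ → ℝ}
    {t e : ℤ → ℝ} (h : ShellCheckpoints ε₀ θ c i₀ n₀ X₀ P N X E t e) (hN' : N' ≤ N) :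
    ShellCheckpoints ε₀ θ c i₀ n₀ X₀ P N' X E t e where
  t_init := h.t_init
  e_init := h.e_init
  e_pos n h1 h2 := h.e_pos n h1 (h2.trans hN')
  amp n h1 h2 := h.amp n h1 (h2.trans hN')
  state n h1 h2 := h.state n h1 (h2.trans hN')
  mono n h1 h2 := h.mono n h1 (h2.trans hN')
  life n h1 h2 := h.life n h1 (h2.trans hN')
  ratio n h1 h2 := h.ratio n h1 (h2.trans hN')

/-- The anchor time is nonnegative … indeed all checkpoint times are: `0 = t_{n₀} ≤ t_n`.
[cite: Tao2016AveragedNS, §6.2 Prop. 6.3 (vii), (6.9)] -/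
theorem ShellCheckpoints.t_nonneg {ε₀ θ c : ℝ} {m : ℕ} {i₀ : Fin m} {n₀ : ℤ} {X₀ : Fin m → ℝ}
    {P : (Fin m → ℤ → ℝ) → (Fin m → ℤ → ℝ) → Prop} {N : ℤ} {X E : Fin m → ℤ → ℝ → ℝ}
    {t e : ℤ → ℝ} (h : ShellCheckpoints ε₀ θ c i₀ n₀ X₀ P N X E t e) :
    ∀ n, n₀ ≤ n → n ≤ N → 0 ≤ t n := by
  intro n hn hnN
  -- induction on `n - n₀`
  obtain ⟨k, rfl⟩ : ∃ k : ℕ, n = n₀ + k := ⟨(n - n₀).toNat, by omega⟩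
  induction k with
  | zero => simp [h.t_init]
  | succ k ih =>
      have h1 : n₀ ≤ n₀ + (k : ℤ) := by omega
      have h2 : n₀ + (k : ℤ) ≤ N := by omega
      have hlt := h.mono (n₀ + (k + 1 : ℕ)) (by omega) hnN
      have : (n₀ + ((k + 1 : ℕ) : ℤ)) - 1 = n₀ + (k : ℤ) := by push_cast; ring
      rw [this] at hlt
      exact (ih h1 h2).trans hlt.le

/-! ### Theorem 6.2 ⇐ Proposition 6.3 for an arbitrary table: checkpoints at every level contradict the a priori bound -/

section Contradiction

variable {ε₀ θ c : ℝ} {m : ℕ} {i₀ : Fin m} {n₀ : ℤ} {X₀ : Fin m → ℝ}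
  {P : (Fin m → ℤ → ℝ) → (Fin m → ℤ → ℝ) → Prop} {N : ℤ} {X E : Fin m → ℤ → ℝ → ℝ} {t e : ℤ → ℝ}

/-- **Amplitude decay is at most geometric**: `e_n ≥ (1+ε₀)^{-θ(n-n₀)} e_{n₀}`.
[cite: Tao2016AveragedNS, §6.2 p. 32 ("e_N ≥ (1+ε₀)^{-(N-n₀)/10}")] -/
theorem ShellCheckpoints.rpow_mul_le_amp (h : ShellCheckpoints ε₀ θ c i₀ n₀ X₀ P N X E t e)
    (hε₀ : 0 < ε₀) : ∀ n, n₀ ≤ n → n ≤ N → (1 + ε₀) ^ (-θ * (n - n₀)) * |X₀ i₀| ≤ e n := by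
  intro n hn hnN
  have hq0 : (0 : ℝ) < 1 + ε₀ := by linarith
  obtain ⟨k, rfl⟩ : ∃ k : ℕ, n = n₀ + k := ⟨(n - n₀).toNat, by omega⟩
  induction k with
  | zero => simp [h.e_init]
  | succ k ih =>
      have h2 : n₀ + (k : ℤ) ≤ N := by omega
      have hr := h.ratio (n₀ + (k + 1 : ℕ)) (by omega) hnN
      have hidx : (n₀ + ((k + 1 : ℕ) : ℤ)) - 1 = n₀ + (k : ℤ) := by push_cast; ring
      rw [hidx] at hr
      have ih' := ih (by omega) h2
      have hexp : -θ * (((n₀ + ((k + 1 : ℕ) : ℤ) : ℤ) : ℝ) - n₀) =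
          -θ + -θ * (((n₀ + (k : ℤ) : ℤ) : ℝ) - n₀) := by
        push_cast; ring
      rw [hexp, Real.rpow_add hq0, mul_assoc]
      exact (mul_le_mul_of_nonneg_left ih' (Real.rpow_pos_of_pos hq0 _).le).trans hr

/-- **The lifespans are summable for `θ < 5/2`**: with `r = (1+ε₀)^{θ - 5/2} < 1`,
`t_n ≤ (c/e_{n₀}) (1+ε₀)^{-5n₀/2} (1 - r^{n-n₀})/(1 - r)`.
[cite: Tao2016AveragedNS, §6.2 p. 32 ("the lifespans t_n − t_{n−1} are summable uniformly in N")] -/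
theorem ShellCheckpoints.time_le (h : ShellCheckpoints ε₀ θ c i₀ n₀ X₀ P N X E t e)
    (hε₀ : 0 < ε₀) (hθ : θ < 5 / 2) (hc : 0 ≤ c) :
    ∀ n, n₀ ≤ n → n ≤ N →
      t n ≤ c * |X₀ i₀|⁻¹ * (1 + ε₀) ^ (-(5 : ℝ) * n₀ / 2) *
        ((1 - (1 + ε₀) ^ ((θ - 5 / 2) * (n - n₀))) / (1 - (1 + ε₀) ^ (θ - 5 / 2))) := by
  intro n hn hnN
  have hq0 : (0 : ℝ) < 1 + ε₀ := by linarith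
  have hq1 : (1 : ℝ) < 1 + ε₀ := by linarith
  have hr1 : (1 + ε₀) ^ (θ - 5 / 2) < 1 := Real.rpow_lt_one_of_one_lt_of_neg hq1 (by linarith)
  have h1r : 0 < 1 - (1 + ε₀) ^ (θ - 5 / 2) := by linarith
  have ha : 0 < |X₀ i₀| := by rw [← h.e_init]; exact h.e_pos n₀ le_rfl (hn.trans hnN)
  obtain ⟨k, rfl⟩ : ∃ k : ℕ, n = n₀ + k := ⟨(n - n₀).toNat, by omega⟩
  induction k with
  | zero =>
      simp only [CharP.cast_eq_zero, add_zero, sub_self, mul_zero, Real.rpow_zero, zero_div, h.t_init]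
      rfl
  | succ k ih =>
      have h2 : n₀ + (k : ℤ) ≤ N := by omega
      have ih' := ih (by omega) h2
      have hl := h.life (n₀ + (k + 1 : ℕ)) (by omega) hnN
      have hidx : (n₀ + ((k + 1 : ℕ) : ℤ)) - 1 = n₀ + (k : ℤ) := by push_cast; ring
      have hcast : (((n₀ + ((k + 1 : ℕ) : ℤ) : ℤ) : ℝ) - 1) = (((n₀ + (k : ℤ) : ℤ) : ℝ)) := by
        push_cast; ring
      rw [hidx, hcast] at hl
      -- `1/e_{n₀+k} ≤ (1+ε₀)^{θ k}/|X₀ i₀|`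
      have hek := h.rpow_mul_le_amp hε₀ (n₀ + k) (by omega) h2
      have hekpos := h.e_pos (n₀ + k) (by omega) h2
      have hinv : (e (n₀ + k))⁻¹ ≤ (1 + ε₀) ^ (θ * (((n₀ + (k : ℤ) : ℤ) : ℝ) - n₀)) * |X₀ i₀|⁻¹ := by
        rw [inv_le_comm₀ hekpos (by positivity), mul_inv, ← Real.rpow_neg hq0.le, inv_inv, ← neg_mul]
        exact hek
      -- the new lifespan is the next term of the geometric series
      have hterm : c * (1 + ε₀) ^ (-(5 : ℝ) * (((n₀ + (k : ℤ) : ℤ) : ℝ)) / 2) * (e (n₀ + k))⁻¹ ≤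
          c * |X₀ i₀|⁻¹ * (1 + ε₀) ^ (-(5 : ℝ) * n₀ / 2) *
            (1 + ε₀) ^ ((θ - 5 / 2) * (((n₀ + (k : ℤ) : ℤ) : ℝ) - n₀)) := by
        calc c * (1 + ε₀) ^ (-(5 : ℝ) * (((n₀ + (k : ℤ) : ℤ) : ℝ)) / 2) * (e (n₀ + k))⁻¹
            ≤ c * (1 + ε₀) ^ (-(5 : ℝ) * (((n₀ + (k : ℤ) : ℤ) : ℝ)) / 2) *
                ((1 + ε₀) ^ (θ * (((n₀ + (k : ℤ) : ℤ) : ℝ) - n₀)) * |X₀ i₀|⁻¹) :=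
              mul_le_mul_of_nonneg_left hinv (by positivity)
          _ = c * |X₀ i₀|⁻¹ * (1 + ε₀) ^ (-(5 : ℝ) * n₀ / 2) *
                (1 + ε₀) ^ ((θ - 5 / 2) * (((n₀ + (k : ℤ) : ℤ) : ℝ) - n₀)) := by
              have hexp : -(5 : ℝ) * (((n₀ + (k : ℤ) : ℤ) : ℝ)) / 2 + θ * (((n₀ + (k : ℤ) : ℤ) : ℝ) - n₀) =
                  -(5 : ℝ) * n₀ / 2 + (θ - 5 / 2) * (((n₀ + (k : ℤ) : ℤ) : ℝ) - n₀) := by ring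
              have hpow : (1 + ε₀) ^ (-(5 : ℝ) * (((n₀ + (k : ℤ) : ℤ) : ℝ)) / 2) *
                  (1 + ε₀) ^ (θ * (((n₀ + (k : ℤ) : ℤ) : ℝ) - n₀)) =
                  (1 + ε₀) ^ (-(5 : ℝ) * n₀ / 2) *
                    (1 + ε₀) ^ ((θ - 5 / 2) * (((n₀ + (k : ℤ) : ℤ) : ℝ) - n₀)) := by
                rw [← Real.rpow_add hq0, hexp, Real.rpow_add hq0]
              rw [show ∀ (A B r : ℝ), c * A * (B * r) = c * r * (A * B) from fun A B r => by ring,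
                hpow]
              ring
      have hsum : (1 - (1 + ε₀) ^ ((θ - 5 / 2) * (((n₀ + (k : ℤ) : ℤ) : ℝ) - n₀))) /
            (1 - (1 + ε₀) ^ (θ - 5 / 2)) +
          (1 + ε₀) ^ ((θ - 5 / 2) * (((n₀ + (k : ℤ) : ℤ) : ℝ) - n₀)) =
          (1 - (1 + ε₀) ^ ((θ - 5 / 2) * (((n₀ + ((k + 1 : ℕ) : ℤ) : ℤ) : ℝ) - n₀))) /
            (1 - (1 + ε₀) ^ (θ - 5 / 2)) := by
        have hexp : (θ - 5 / 2) * (((n₀ + ((k + 1 : ℕ) : ℤ) : ℤ) : ℝ) - n₀) =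
            (θ - 5 / 2) * (((n₀ + (k : ℤ) : ℤ) : ℝ) - n₀) + (θ - 5 / 2) := by push_cast; ring
        have hne : 1 - (1 + ε₀) ^ (θ - 5 / 2) ≠ 0 := h1r.ne'
        rw [hexp, Real.rpow_add hq0, eq_div_iff hne, add_mul, div_mul_cancel₀ _ hne]
        ring
      calc t (n₀ + ((k + 1 : ℕ) : ℤ))
          ≤ t (n₀ + k) + c * (1 + ε₀) ^ (-(5 : ℝ) * (((n₀ + (k : ℤ) : ℤ) : ℝ)) / 2) * (e (n₀ + k))⁻¹ := by
            linarith
        _ ≤ c * |X₀ i₀|⁻¹ * (1 + ε₀) ^ (-(5 : ℝ) * n₀ / 2) *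
              ((1 - (1 + ε₀) ^ ((θ - 5 / 2) * (((n₀ + (k : ℤ) : ℤ) : ℝ) - n₀))) /
                (1 - (1 + ε₀) ^ (θ - 5 / 2))) +
            c * |X₀ i₀|⁻¹ * (1 + ε₀) ^ (-(5 : ℝ) * n₀ / 2) *
              (1 + ε₀) ^ ((θ - 5 / 2) * (((n₀ + (k : ℤ) : ℤ) : ℝ) - n₀)) := add_le_add ih' hterm
        _ = c * |X₀ i₀|⁻¹ * (1 + ε₀) ^ (-(5 : ℝ) * n₀ / 2) *
              ((1 - (1 + ε₀) ^ ((θ - 5 / 2) * (((n₀ + ((k + 1 : ℕ) : ℤ) : ℤ) : ℝ) - n₀))) /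
                (1 - (1 + ε₀) ^ (θ - 5 / 2))) := by
            rw [← hsum]
            ring

/-- **Uniform time horizon**: `0 ≤ t_N ≤ T₀ := (c/e_{n₀}) (1+ε₀)^{-5n₀/2}/(1 - (1+ε₀)^{θ-5/2})`,
uniformly in the level `N`. [cite: Tao2016AveragedNS, §6.2 p. 32] -/
theorem ShellCheckpoints.time_le_uniform (h : ShellCheckpoints ε₀ θ c i₀ n₀ X₀ P N X E t e)
    (hε₀ : 0 < ε₀) (hθ : θ < 5 / 2) (hc : 0 ≤ c) (hN : n₀ ≤ N) :
    0 ≤ t N ∧ t N ≤ c * |X₀ i₀|⁻¹ * (1 + ε₀) ^ (-(5 : ℝ) * n₀ / 2) / (1 - (1 + ε₀) ^ (θ - 5 / 2)) := by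
  have hq0 : (0 : ℝ) < 1 + ε₀ := by linarith
  have hq1 : (1 : ℝ) < 1 + ε₀ := by linarith
  have hr1 : (1 + ε₀) ^ (θ - 5 / 2) < 1 := Real.rpow_lt_one_of_one_lt_of_neg hq1 (by linarith)
  have h1r : 0 < 1 - (1 + ε₀) ^ (θ - 5 / 2) := by linarith
  have ha : 0 ≤ |X₀ i₀|⁻¹ := inv_nonneg.mpr (abs_nonneg _)
  have hfrac : (1 - (1 + ε₀) ^ ((θ - 5 / 2) * ((N : ℝ) - n₀))) / (1 - (1 + ε₀) ^ (θ - 5 / 2)) ≤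
      1 / (1 - (1 + ε₀) ^ (θ - 5 / 2)) :=
    div_le_div_of_nonneg_right
      (by linarith [Real.rpow_pos_of_pos hq0 ((θ - 5 / 2) * ((N : ℝ) - n₀))]) h1r.le
  refine ⟨h.t_nonneg N hN le_rfl, (h.time_le hε₀ hθ hc N hN le_rfl).trans ?_⟩
  calc c * |X₀ i₀|⁻¹ * (1 + ε₀) ^ (-(5 : ℝ) * n₀ / 2) *
        ((1 - (1 + ε₀) ^ ((θ - 5 / 2) * ((N : ℝ) - n₀))) / (1 - (1 + ε₀) ^ (θ - 5 / 2)))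
      ≤ c * |X₀ i₀|⁻¹ * (1 + ε₀) ^ (-(5 : ℝ) * n₀ / 2) * (1 / (1 - (1 + ε₀) ^ (θ - 5 / 2))) :=
        mul_le_mul_of_nonneg_left hfrac (by positivity)
    _ = _ := by rw [mul_one_div]

/-- **Theorem 6.2 ⇐ Proposition 6.3, for an arbitrary table** (the last paragraph of Tao's §6.2,
with general ratio exponent `θ < 5/2` and clock constant `c ≥ 0`): if a GLOBAL pseudo-solution admits
shell checkpoints up to every level `N ≥ n₀`, contradiction — the lifespans are summable uniformly
in `N` (`time_le_uniform`) while `(1+(1+ε₀)^{10N}) e_N ≥ |X₀ i₀| (1+ε₀)^{(10-θ)N + θn₀} → ∞`, against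
the a priori bound (4.5) on `[0, T₀+1]`. Tao's instance: `θ = 1/10`, `c ≍ 1` (tree:
`TaoODESystem.false_of_blowupCheckpoints`). [cite: Tao2016AveragedNS, §6.2 p. 32 (Thm. 6.2 from Prop. 6.3)] -/
theorem CascadeODESolutionFrom.false_of_shellCheckpoints {α : Fin m → Fin m → Fin m → ℤ × ℤ × ℤ → ℝ}
    {K₁ K₂ : ℝ} (hε₀ : 0 < ε₀) (hθ : θ < 5 / 2) (hc : 0 ≤ c)
    (hsol : CascadeODESolutionFrom ε₀ α K₁ K₂ n₀ X₀ X E)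
    (hdyn : ∀ N : ℤ, n₀ ≤ N → ∃ t e : ℤ → ℝ, ShellCheckpoints ε₀ θ c i₀ n₀ X₀ P N X E t e) :
    False := by
  have hq0 : (0 : ℝ) < 1 + ε₀ := by linarith
  have hq1 : (1 : ℝ) < 1 + ε₀ := by linarith
  have hr1 : (1 + ε₀) ^ (θ - 5 / 2) < 1 := Real.rpow_lt_one_of_one_lt_of_neg hq1 (by linarith)
  have h1r : 0 < 1 - (1 + ε₀) ^ (θ - 5 / 2) := by linarith
  -- the datum amplitude is positive (level-`n₀` checkpoints)
  have ha : 0 < |X₀ i₀| := by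
    obtain ⟨t, e, h⟩ := hdyn n₀ le_rfl
    rw [← h.e_init]
    exact h.e_pos n₀ le_rfl le_rfl
  -- the uniform time horizon
  set T : ℝ := c * |X₀ i₀|⁻¹ * (1 + ε₀) ^ (-(5 : ℝ) * n₀ / 2) / (1 - (1 + ε₀) ^ (θ - 5 / 2)) + 1
    with hT
  have hT0 : 0 ≤ c * |X₀ i₀|⁻¹ * (1 + ε₀) ^ (-(5 : ℝ) * n₀ / 2) / (1 - (1 + ε₀) ^ (θ - 5 / 2)) :=
    div_nonneg (by positivity) h1r.le
  have hTpos : 0 < T := by linarith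
  obtain ⟨M, hM⟩ := hsol.apriori_X T hTpos
  -- `|X₀ i₀| (1+ε₀)^{(10-θ)N + θ n₀} ≤ M` for every `N ≥ n₀`
  have hbound : ∀ N : ℤ, n₀ ≤ N → |X₀ i₀| * (1 + ε₀) ^ ((10 - θ) * N + θ * n₀) ≤ M := by
    intro N hN
    obtain ⟨t, e, h⟩ := hdyn N hN
    obtain ⟨ht0, htT⟩ := h.time_le_uniform hε₀ hθ hc hN
    have hMN := hM (t N) ⟨ht0, by linarith⟩ i₀ N
    have hamp := h.amp N hN le_rfl
    have heN := h.rpow_mul_le_amp hε₀ N hN le_rfl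
    have hpos10 := Real.rpow_pos_of_pos hq0 ((10 : ℝ) * N)
    calc |X₀ i₀| * (1 + ε₀) ^ ((10 - θ) * N + θ * n₀)
        = (1 + ε₀) ^ ((10 : ℝ) * N) * ((1 + ε₀) ^ (-θ * (N - n₀)) * |X₀ i₀|) := by
          have hexp : (10 - θ) * (N : ℝ) + θ * n₀ = (10 : ℝ) * N + -θ * (N - n₀) := by ring
          rw [hexp, Real.rpow_add hq0]
          ring
      _ ≤ (1 + (1 + ε₀) ^ ((10 : ℝ) * N)) * e N :=
          mul_le_mul (by linarith) heN (by positivity) (by positivity)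
      _ ≤ (1 + (1 + ε₀) ^ ((10 : ℝ) * N)) * |X i₀ N (t N)| :=
          mul_le_mul_of_nonneg_left hamp (by positivity)
      _ ≤ M := hMN
  -- choose `N` with exponent `p = (10-θ)N + θn₀ ≥ 1` and `|X₀ i₀| p ε₀ > M`
  have h10 : (0 : ℝ) < 10 - θ := by linarith
  have haε : 0 < |X₀ i₀| * ε₀ := mul_pos ha hε₀
  obtain ⟨N, hN⟩ := exists_int_gt
    (max (n₀ : ℝ) ((max 1 (M / (|X₀ i₀| * ε₀) + 1) - θ * n₀) / (10 - θ)))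
  have hNn₀ : n₀ ≤ N := by exact_mod_cast ((le_max_left _ _).trans_lt hN).le
  have h2 : max 1 (M / (|X₀ i₀| * ε₀) + 1) < (10 - θ) * N + θ * n₀ := by
    have h2' := (le_max_right _ _).trans_lt hN
    rw [div_lt_iff₀ h10] at h2'
    linarith
  have hp1 : (1 : ℝ) ≤ (10 - θ) * N + θ * n₀ := ((le_max_left _ _).trans h2.le)
  have hpM : M < |X₀ i₀| * (((10 - θ) * N + θ * n₀) * ε₀) := by
    have h4 : M / (|X₀ i₀| * ε₀) < (10 - θ) * N + θ * n₀ := by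
      linarith [le_max_right (1 : ℝ) (M / (|X₀ i₀| * ε₀) + 1)]
    rw [div_lt_iff₀ haε] at h4
    linarith
  -- Bernoulli: `1 + p ε₀ ≤ (1+ε₀)^p`
  have hbern := one_add_mul_self_le_rpow_one_add (s := ε₀) (by linarith) hp1
  have h5 : |X₀ i₀| * (1 + ((10 - θ) * N + θ * n₀) * ε₀) ≤ M :=
    (mul_le_mul_of_nonneg_left hbern ha.le).trans (hbound N hNn₀)
  have h6 : |X₀ i₀| * (1 + ((10 - θ) * N + θ * n₀) * ε₀) =
      |X₀ i₀| + |X₀ i₀| * (((10 - θ) * N + θ * n₀) * ε₀) := by ring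
  linarith

/-- **No Theorem 4.2-level escape**: if, for all implied constants and all large `n₀`, every global
pseudo-solution from the datum admits shell checkpoints at every level (`θ < 5/2`, `c ≥ 0`), then
the table has Theorem 4.2-level blow-up (`NoGlobalCascade`, defined below, unfolded here).
[cite: Tao2016AveragedNS, §6.2 p. 32 (Thm. 6.2 from Prop. 6.3) with §6.1 p. 31 (Thm. 4.2 from Thm. 6.2)] -/
theorem not_exists_cascadeODESolutionFrom_of_shellCheckpoints
    {α : Fin m → Fin m → Fin m → ℤ × ℤ × ℤ → ℝ} {K₁ K₂ : ℝ} (hε₀ : 0 < ε₀) (hθ : θ < 5 / 2)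
    (hc : 0 ≤ c)
    (hdyn : ∀ X E : Fin m → ℤ → ℝ → ℝ, CascadeODESolutionFrom ε₀ α K₁ K₂ n₀ X₀ X E →
      ∀ N : ℤ, n₀ ≤ N → ∃ t e : ℤ → ℝ, ShellCheckpoints ε₀ θ c i₀ n₀ X₀ P N X E t e) :
    ¬ ∃ X E : Fin m → ℤ → ℝ → ℝ, CascadeODESolutionFrom ε₀ α K₁ K₂ n₀ X₀ X E := by
  rintro ⟨X, E, hsol⟩
  exact hsol.false_of_shellCheckpoints hε₀ hθ hc (hdyn X E hsol)

/-- **The cell's support statement `checkpointContradiction`** (generic "Prop. 6.3 ⇒ Thm. 6.2"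
bookkeeping for every table, every `θ < 5/2`, `c ≥ 0`), as a named proposition; PROVED below
(`checkpointContradiction_holds`). [cite: Tao2016AveragedNS, §6.2 p. 32 (Thm. 6.2 from Prop. 6.3)] -/
def checkpointContradiction : Prop :=
  ∀ (ε₀ θ c : ℝ) (m : ℕ) (i₀ : Fin m) (α : Fin m → Fin m → Fin m → ℤ × ℤ × ℤ → ℝ) (K₁ K₂ : ℝ)
    (n₀ : ℤ) (X₀ : Fin m → ℝ) (P : (Fin m → ℤ → ℝ) → (Fin m → ℤ → ℝ) → Prop)
    (X E : Fin m → ℤ → ℝ → ℝ),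
    0 < ε₀ → θ < 5 / 2 → 0 ≤ c →
      CascadeODESolutionFrom ε₀ α K₁ K₂ n₀ X₀ X E →
        (∀ N : ℤ, n₀ ≤ N → ∃ t e : ℤ → ℝ, ShellCheckpoints ε₀ θ c i₀ n₀ X₀ P N X E t e) → False

/-- `checkpointContradiction` holds. [cite: Tao2016AveragedNS, §6.2 p. 32 (Thm. 6.2 from Prop. 6.3)] -/
theorem checkpointContradiction_holds : checkpointContradiction :=
  fun _ε₀ _θ _c _m _i₀ _α _K₁ _K₂ _n₀ _X₀ _P _X _E hε₀ hθ hc hsol hdyn =>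
    hsol.false_of_shellCheckpoints hε₀ hθ hc hdyn

end Contradiction

/-! ### The rescaled one-shell datum -/

/-- The rescaled datum state `k ↦ X_{i,n₀+k}(0)/|X₀ i₀|` of the one-shell datum `X₀`.
[cite: Tao2016AveragedNS, §6.2 (6.9)–(6.10) and §4 (4.7)] -/
def datumState {m : ℕ} (i₀ : Fin m) (X₀ : Fin m → ℝ) : Fin m → ℤ → ℝ :=
  fun i k => (if k = 0 then X₀ i else 0) / |X₀ i₀|

/-- The rescaled datum energies `k ↦ E_{i,n₀+k}(0)/X₀ i₀² = ½ X_{i,n₀+k}(0)²/X₀ i₀²`.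
[cite: Tao2016AveragedNS, §6.2 (6.9)–(6.10) and §4 (4.6)–(4.7)] -/
def datumEnergy {m : ℕ} (i₀ : Fin m) (X₀ : Fin m → ℝ) : Fin m → ℤ → ℝ :=
  fun i k => (if k = 0 then (1 / 2) * X₀ i ^ 2 else 0) / |X₀ i₀| ^ 2

/-- Unfolding `datumState`. [cite: Tao2016AveragedNS, §4 (4.7)] -/
theorem datumState_apply {m : ℕ} (i₀ : Fin m) (X₀ : Fin m → ℝ) (i : Fin m) (k : ℤ) :
    datumState i₀ X₀ i k = (if k = 0 then X₀ i else 0) / |X₀ i₀| := rfl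

/-- Unfolding `datumEnergy`. [cite: Tao2016AveragedNS, §4 (4.6)] -/
theorem datumEnergy_apply {m : ℕ} (i₀ : Fin m) (X₀ : Fin m → ℝ) (i : Fin m) (k : ℤ) :
    datumEnergy i₀ X₀ i k = (if k = 0 then (1 / 2) * X₀ i ^ 2 else 0) / |X₀ i₀| ^ 2 := rfl

/-- Off the datum shell the rescaled state vanishes. [cite: Tao2016AveragedNS, §4 (4.7)] -/
theorem datumState_of_ne {m : ℕ} (i₀ : Fin m) (X₀ : Fin m → ℝ) (i : Fin m) {k : ℤ} (hk : k ≠ 0) :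
    datumState i₀ X₀ i k = 0 := by
  rw [datumState_apply, if_neg hk, zero_div]

/-- The observable mode of the rescaled datum has modulus one (if charged).
[cite: Tao2016AveragedNS, §6.2 (6.10)] -/
theorem abs_datumState_self {m : ℕ} (i₀ : Fin m) (X₀ : Fin m → ℝ) (h : X₀ i₀ ≠ 0) :
    |datumState i₀ X₀ i₀ 0| = 1 := by
  rw [datumState_apply, if_pos rfl, abs_div, abs_abs, div_self (abs_ne_zero.mpr h)]

/-- The rescaled window state of a local pseudo-solution at the anchor checkpoint (`t_{n₀} = 0`,
`e_{n₀} = |X₀ i₀|`) is the rescaled datum. [cite: Tao2016AveragedNS, §4 (4.7), §6.2 (6.9)–(6.10)] -/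
theorem CascadeODESolutionOn.window_zero {T ε₀ : ℝ} {m : ℕ}
    {α : Fin m → Fin m → Fin m → ℤ × ℤ × ℤ → ℝ} {K₁ K₂ : ℝ} {n₀ : ℤ} {X₀ : Fin m → ℝ}
    {X E : Fin m → ℤ → ℝ → ℝ} (h : CascadeODESolutionOn T ε₀ α K₁ K₂ n₀ X₀ X E) (i₀ : Fin m) :
    (fun i k => X i (n₀ + k) 0 / |X₀ i₀|) = datumState i₀ X₀ ∧
      (fun i k => E i (n₀ + k) 0 / |X₀ i₀| ^ 2) = datumEnergy i₀ X₀ := by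
  constructor
  · funext i k
    rw [datumState_apply, h.init_X]
    by_cases hk : k = 0
    · rw [if_pos hk, if_pos (by rw [hk, add_zero])]
    · rw [if_neg hk, if_neg (by intro h'; exact hk (by omega))]
  · funext i k
    rw [datumEnergy_apply, h.init_E, h.init_X]
    by_cases hk : k = 0
    · rw [if_pos hk, if_pos (by rw [hk, add_zero])]
    · rw [if_neg hk, if_neg (by intro h'; exact hk (by omega))]
      ring

/-! ### Cell vocabulary (harvest/h2-tao-ladder): comparable tables and Theorem 4.2-level blow-up

The following PREDICATES are the cell's generalisations of objects of Tao 2016 §4/§6.1 to an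
arbitrary table; they assert nothing. -/

section CellVocabulary

/-- **Comparability with spread `R`** (cell class E₂(R); compare Tao's §6.1 table, whose non-zero
structure constants range over `≍ ε⁻² e^{K¹⁰}` under `1 ≪ 1/ε₀ ≪ K ≪ 1/ε`): on the shift set every
structure constant has modulus `≤ 1` (normalisation) and every NON-ZERO one has modulus `≥ R⁻¹`.
[cite: Tao2016AveragedNS, §6.1 (6.1)–(6.4) (the table being compared); cell vocabulary] -/
def IsComparableCoeff (R : ℝ) {m : ℕ} (α : Fin m → Fin m → Fin m → ℤ × ℤ × ℤ → ℝ) : Prop :=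
  ∀ (i₁ i₂ i₃ : Fin m) (μ : ℤ × ℤ × ℤ), μ ∈ shiftSet →
    |α i₁ i₂ i₃ μ| ≤ 1 ∧ (α i₁ i₂ i₃ μ = 0 ∨ R⁻¹ ≤ |α i₁ i₂ i₃ μ|)

/-- **The table class E₂(R)**: symmetric (4.2), cancelling (4.3) and `R`-comparable structure
constants on Tao's topology `S`. [cite: Tao2016AveragedNS, §4 (4.2)–(4.3); cell vocabulary] -/
def InTableClass (R : ℝ) {m : ℕ} (α : Fin m → Fin m → Fin m → ℤ × ℤ × ℤ → ℝ) : Prop :=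
  IsSymmetricCoeff α ∧ IsCancellingCoeff α ∧ IsComparableCoeff R α

/-- Unfolding `InTableClass`. [cite: Tao2016AveragedNS, §4 (4.2)–(4.3); cell vocabulary] -/
theorem inTableClass_iff (R : ℝ) {m : ℕ} (α : Fin m → Fin m → Fin m → ℤ × ℤ × ℤ → ℝ) :
    InTableClass R α ↔ IsSymmetricCoeff α ∧ IsCancellingCoeff α ∧ IsComparableCoeff R α := Iff.rfl

/-- Comparability is monotone in the spread. [cite: Tao2016AveragedNS, §6.1; cell vocabulary] -/
theorem IsComparableCoeff.mono {R R' : ℝ} {m : ℕ} {α : Fin m → Fin m → Fin m → ℤ × ℤ × ℤ → ℝ}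
    (h : IsComparableCoeff R α) (hR : 0 < R) (hRR' : R ≤ R') : IsComparableCoeff R' α := by
  intro i₁ i₂ i₃ μ hμ
  obtain ⟨h1, h2⟩ := h i₁ i₂ i₃ μ hμ
  refine ⟨h1, h2.imp_right fun h3 => (inv_anti₀ hR hRR').trans h3⟩

/-- **No global pseudo-solution ("Theorem 4.2-level blow-up") for the table `α`** at scale ratio
`1+ε₀` from the one-shell datum `X₀` at shell `n₀`: for all implied constants `K₁, K₂ ≥ 0` and all
sufficiently large `n₀`, no global family obeys the conclusions (4.5)–(4.11) of Lemma 4.1. Tao's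
Theorem 4.2 asserts this for his §6.1 table and `X₀ = 1_{i₀}`.
[cite: Tao2016AveragedNS, §4 Thm. 4.2 (statement shape); cell vocabulary] -/
def NoGlobalCascade (ε₀ : ℝ) {m : ℕ} (α : Fin m → Fin m → Fin m → ℤ × ℤ × ℤ → ℝ)
    (X₀ : Fin m → ℝ) : Prop :=
  ∀ K₁ K₂ : ℝ, 0 ≤ K₁ → 0 ≤ K₂ → ∃ N₀ : ℤ, ∀ n₀ : ℤ, N₀ ≤ n₀ →
    ¬ ∃ X E : Fin m → ℤ → ℝ → ℝ, CascadeODESolutionFrom ε₀ α K₁ K₂ n₀ X₀ X E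

/-- **Checkpoints at every level force Theorem 4.2-level blow-up**: if for all implied constants
`K₁, K₂ ≥ 0` and all large `n₀` every global pseudo-solution from the datum admits shell checkpoints
at every level (`θ < 5/2`, `c ≥ 0`), then `NoGlobalCascade ε₀ α X₀`.
[cite: Tao2016AveragedNS, §6.2 p. 32 with §6.1 p. 31; cell vocabulary] -/
theorem noGlobalCascade_of_forall_shellCheckpoints {ε₀ θ c : ℝ} {m : ℕ} {i₀ : Fin m}
    {α : Fin m → Fin m → Fin m → ℤ × ℤ × ℤ → ℝ} {X₀ : Fin m → ℝ}
    {P : (Fin m → ℤ → ℝ) → (Fin m → ℤ → ℝ) → Prop} (hε₀ : 0 < ε₀) (hθ : θ < 5 / 2) (hc : 0 ≤ c)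
    (h : ∀ K₁ K₂ : ℝ, 0 ≤ K₁ → 0 ≤ K₂ → ∃ N₀ : ℤ, ∀ n₀ : ℤ, N₀ ≤ n₀ →
      ∀ X E : Fin m → ℤ → ℝ → ℝ, CascadeODESolutionFrom ε₀ α K₁ K₂ n₀ X₀ X E →
        ∀ N : ℤ, n₀ ≤ N → ∃ t e : ℤ → ℝ, ShellCheckpoints ε₀ θ c i₀ n₀ X₀ P N X E t e) :
    NoGlobalCascade ε₀ α X₀ := by
  intro K₁ K₂ hK₁ hK₂
  obtain ⟨N₀, hN₀⟩ := h K₁ K₂ hK₁ hK₂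
  exact ⟨N₀, fun n₀ hn₀ =>
    not_exists_cascadeODESolutionFrom_of_shellCheckpoints hε₀ hθ hc (hN₀ n₀ hn₀)⟩

/-- **No global EXACT (inviscid) pseudo-solution, eventually in `n₀`**: the `K₁ = K₂ = 0` slice of
`NoGlobalCascade`. [cite: Tao2016AveragedNS, §4 Thm. 4.2 and (4.12); cell vocabulary] -/
def NoGlobalExactCascade (ε₀ : ℝ) {m : ℕ} (α : Fin m → Fin m → Fin m → ℤ × ℤ × ℤ → ℝ)
    (X₀ : Fin m → ℝ) : Prop :=
  ∃ N₀ : ℤ, ∀ n₀ : ℤ, N₀ ≤ n₀ →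
    ¬ ∃ X E : Fin m → ℤ → ℝ → ℝ, CascadeODESolutionFrom ε₀ α 0 0 n₀ X₀ X E

/-- Theorem 4.2-level blow-up contains its exact slice. [cite: Tao2016AveragedNS, §4 Thm. 4.2; cell vocabulary] -/
theorem NoGlobalCascade.exact {ε₀ : ℝ} {m : ℕ} {α : Fin m → Fin m → Fin m → ℤ × ℤ × ℤ → ℝ}
    {X₀ : Fin m → ℝ} (h : NoGlobalCascade ε₀ α X₀) : NoGlobalExactCascade ε₀ α X₀ :=
  h 0 0 le_rfl le_rfl

/-- **The local robust transition-state induction for the comparable class with spread `R`**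
("Prop. 6.4♮-loc" of the cell; compare Tao's Prop. 6.4): there is a threshold `ε_*` such that for
every `ε₀ ∈ (0, ε_*]` some `R`-comparable symmetric cancelling four-mode table, one-shell datum
(observable mode `i₀` charged) and transition-state description `P` (with `θ < 5/2` and clock
constant `c`) satisfy: (base) `P` holds at the rescaled datum; (step) for all implied constants and
all large `n₀`, along every LOCAL pseudo-solution on `[0,T]`, checkpoints up to level `N` whose next
lifespan fits inside `[0,T]` extend to level `N+1`. A predicate on `R`; nothing is asserted.
[cite: Tao2016AveragedNS, §6.2 Props. 6.3–6.4 (statement shape); cell vocabulary] -/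
def ComparableDynamicsLocal (R : ℝ) : Prop :=
  ∃ εs : ℝ, 0 < εs ∧ εs < 1 ∧ ∀ ε₀ : ℝ, 0 < ε₀ → ε₀ ≤ εs →
    ∃ (θ c : ℝ) (i₀ : Fin 4) (α : Fin 4 → Fin 4 → Fin 4 → ℤ × ℤ × ℤ → ℝ) (X₀ : Fin 4 → ℝ)
      (P : (Fin 4 → ℤ → ℝ) → (Fin 4 → ℤ → ℝ) → Prop),
      θ < 5 / 2 ∧ 0 ≤ c ∧ InTableClass R α ∧ X₀ i₀ ≠ 0 ∧
        P (datumState i₀ X₀) (datumEnergy i₀ X₀) ∧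
        ∀ K₁ K₂ : ℝ, 0 ≤ K₁ → 0 ≤ K₂ → ∃ N₀ : ℤ, ∀ n₀ : ℤ, N₀ ≤ n₀ →
          ∀ T : ℝ, 0 < T → ∀ X E : Fin 4 → ℤ → ℝ → ℝ,
            CascadeODESolutionOn T ε₀ α K₁ K₂ n₀ X₀ X E →
              ∀ N : ℤ, n₀ ≤ N → ∀ t e : ℤ → ℝ, ShellCheckpoints ε₀ θ c i₀ n₀ X₀ P N X E t e →
                t N + c * (1 + ε₀) ^ (-(5 : ℝ) * N / 2) * (e N)⁻¹ ≤ T →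
                  ∃ s a : ℝ, ShellCheckpoints ε₀ θ c i₀ n₀ X₀ P (N + 1) X E
                    (Function.update t (N + 1) s) (Function.update e (N + 1) a)

end CellVocabulary

end TaoCascade

end Literature.Analysis.FluidPDE

end
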